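import Summits.BirchSwinnertonDyer.BirchSwinnertonDyer.Theorems.AdditiveBranchIMCMultLowerBranchTransportClasses
import Summits.BirchSwinnertonDyer.BirchSwinnertonDyer.Theorems.AdditiveBranchIMCMultLowerKatoTrivialBranch
import Summits.BirchSwinnertonDyer.Rank1Residual.Additive.TwistRamTransport
import HarnessLib

/-!
# Route `AdditiveBranchIMC` (rung K1), crux `MultLower` (item `stmt-BirchSwinnertonDyer-19359`):
# rank `0` on X4(M) ∩ {ρ̄ onto} ∩ (ram) — the lower half MODULO (BC) and ONE unit coefficient,
# every other input PUBLISHED (Skinner 2016 Thm. A supplies (KV))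

Sequel of `AdditiveBranchIMCMultLowerBranchTransport{,Classes}.lean`, `…KatoTrivialBranch.lean` and
`…RankZero.lean`. There the rank-`0` lower half on cell (M) was obtained from two displayed inputs, (KV)
(Kato's direction for the multiplicative twist `V` on the trivial branch) and (BC) (the base-change
product bound), plus a finite `μ = 0` certificate. THIS FILE removes (KV) from the displayed list on the
rows where it is PRINT: `E[p]` irreducible with `ρ̄_{E,p}` onto and (ram) — a multiplicative prime
`ℓ ≠ p` of `E` with `p ∤ v_ℓ(Δ_min(E))` (`Rank1Residual.Ram W p`; it transports to the twist model by
`ram_of_twist_pStar`, and irreducibility by `irr_iff_of_model_twist`) — through Skinner 2016 Thm. A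
(`Skinner2016.thmA_charIdeal_multiplicative`, consumed by `katoV_of_skinner2016` at the newform of a
modular parametrisation datum of `V`, whose rational period ratio `ϖ·Ω_V = Ω⁺_f` exists by
`ModularParametrizationData.exists_rat_mul_realPeriodRat_eq_plusPeriod`). Because (KV) is then available
only at parametrisation data, (BC) is displayed at parametrisation data too, and the `T = 0` consumers of
n1011-p06 (`cycLowerLeadingTermAt_of_chiBranchRatCharEqMult[Odd]_of_unitCoeff`) are re-run PER DATUM
(§1, same proofs: Birch + Pal / the odd Birch identity, MTT §I.14, `k ≥ 0` from the unit coefficient).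

HEADLINE (§2) `ClassX4M.missingLowerBoundAt_rankZero_of_skinner_of_baseChangeLower_of_unitCoeff`: for
`W` globally minimal, `(E, p) ∈` X4(M) (odd additive potentially multiplicative `p`, `E[p]` irreducible),
`ρ̄_{E,p}` onto, (ram), `r_an = 0`: PUBLISHED `hDelX` (Delbourgo 1998 Prop. 4 + §2.2 Lemma (ii)), `hPal`
(Pal 2012, `p ≡ 1 (4)` only), `hGZK`, `hmod`, `hmodD`, `hK` (Kato 2004 Thm. 17.4 (3) reading), `hA`
(Skinner 2016 Thm. A) + DISPLAYED **(BC)** at parametrisation data + the unit-coefficient certificate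
`MultBranchUnitCoeffCert` / `MultOddBranchUnitCoeffCert` ⟹ `MissingLowerBoundAt W p` (= `stub_rankZero`
at the pair). So on these rows the crux in rank `0` is EXACTLY: (BC) — NOT in print (`p ∣ d_K`) — plus
one modular-symbol computation per pair. Theorems only; conditional; cell (M) stays CONSTRUCTION-shaped;
nothing booked.

References: Skinner, Pacific J. Math. 283 (2016) Thm. A, §3.2–3.3 [Skinner2016PacificMC]; Kato,
Astérisque 295 (2004) Thm. 17.4 (3) [Kato2004Asterisque]; Delbourgo, Compositio Math. 113 (1998) Prop. 4,
§2.2 Lemma (ii) [Delbourgo1998]; Pal, Proc. AMS 2012 Thm. 3.2 [Pal2012]; Mazur–Tate–Teitelbaum 1986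
§I.8, §I.14 [MazurTateTeitelbaum1986Invent]; Burungale–Castella–Skinner, IMRN 2025 Thm. 1.1.2 (a)
[BurungaleCastellaSkinner2025]; Miller 2011 Def. 1.1 [Miller2011LMS].
-/

set_option autoImplicit false
set_option linter.dupNamespace false

noncomputable section

open scoped Classical MatrixGroups ModularForm NumberField

namespace Summit.BirchSwinnertonDyer.BirchSwinnertonDyer.Theorems.AdditiveBranchIMCMultLower

open CongruenceSubgroup WeierstrassCurve NumberField Literature.NumberTheory.EllipticCurves
  Literature.NumberTheory.EllipticCurves.ModularForms
  Literature.NumberTheory.EllipticCurves.Rank1Residual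
  Literature.NumberTheory.EllipticCurves.Rank1Residual.Typed
  IsDedekindDomain
  Summit.BirchSwinnertonDyer.Rank1Residual.Additive
  Summit.BirchSwinnertonDyer.Rank1Residual.AdditivePotMult

variable (W : WeierstrassCurve ℚ) (p : ℕ) [hp : Fact p.Prime]

/-! ### §1 The `T = 0` consumers PER DATUM (n1011-p06's proofs with the branch main conjecture at ONE
twist datum instead of the `∀`-predicate) -/

/-- **(M), `p ≡ 1 (mod 4)`, per datum**: `W = E` additive at `p`, `ℚ`-isomorphic to `V^{(p)}` with `V`
MULTIPLICATIVE at `p`, `f` a newform of `V` with `a_p(f) = ap ∈ {±1}`, `p ∣ N`, `ϖ·Ω_V = Ω⁺_f`; the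
rational branch main conjecture AT THIS DATUM (for every cyclotomic dual datum `D`:
`char X(E/ℚ_∞) = (g)`, `ι g = p^k·ϖ·L⁺_p(f, ap, ω^{(p−1)/2}, T)`) and ONE unit coefficient of
`ϖ·L⁺_p(f, ap, ω^{(p−1)/2}, T)` ⟹ `CycLowerLeadingTermAt W p`. Proof = n1011-p06's
`cycLowerLeadingTermAt_of_chiBranchRatCharEqMult_of_unitCoeff` verbatim with the predicate replaced by
its value at the datum. [cite: MazurTateTeitelbaum1986Invent, §I.14] [cite: Pal2012, Thm. 3.2] -/
theorem cycLowerLeadingTermAt_of_ratCharEqMultDatum_of_unitCoeff {W : WeierstrassCurve ℚ}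
    [W.IsElliptic] [W.IsGloballyMinimal]
    (hPal : Pal2012.thm32_sqrt_mul_realPeriodRat_twist_eq_of_prime_one_mod_four)
    (hmod : hasEntireLFunction_rat) (hp4 : p % 4 = 1) (hadd : Addv W p)
    (V : WeierstrassCurve ℚ) [V.IsElliptic] [V.IsGloballyMinimal]
    (hVW : ∃ C : VariableChange ℚ, C • V.quadraticTwist (p : ℚ) = W) (hV : Mult V p)
    {N : ℕ} [NeZero N] {f : CuspForm (Gamma0 N) 2} (hf : IsNewformOf V f) (hpN : p ∣ N)
    {ap : ℤ} (hap : cuspCoeff f p = ap) (hap1 : ap = 1 ∨ ap = -1)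
    (ϖ : ℚ) (hϖ : (ϖ : ℝ) * V.realPeriodRat = plusPeriod f)
    (hMC : ∀ (κ : ZpExtension ℚ p) (γ : Field.absoluteGaloisGroup ℚ), κ.IsCyclotomic →
      κ.IsTopGenerator γ → IsCyclotomicVariable p γ → ∀ D : W.SelmerDualData κ γ,
      ∃ (g : IwasawaAlgebra p) (k : ℤ), D.charIdeal = Ideal.span {g} ∧
        iwasawaToPowerSeries p g = PowerSeries.C ((p : ℚ_[p]) ^ k * (ϖ : ℚ_[p])) *
          padicLFunctionPlusBranchMult f (ap : ℚ_[p]) (p / 2))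
    (hcert : ∃ n : ℕ, ‖PowerSeries.coeff n
        (PowerSeries.C (ϖ : ℚ_[p]) * padicLFunctionPlusBranchMult f (ap : ℚ_[p]) (p / 2))‖ = 1) :
    CycLowerLeadingTermAt W p := by
  have hpP : p.Prime := hp.out
  have hp2 : p ≠ 2 := by omega
  have hap0 : (ap : ℚ_[p]) ≠ 0 := by rcases hap1 with rfl | rfl <;> norm_num
  have hapinv : (ap : ℚ_[p])⁻¹ = (ap : ℚ_[p]) := by rcases hap1 with rfl | rfl <;> norm_num
  intro κ γ hκ hγ hγ' D f' hf'
  obtain ⟨g, k, hchar, hιg⟩ := hMC κ γ hκ hγ hγ' D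
  have hιg' : iwasawaToPowerSeries p g = PowerSeries.C ((p : ℚ_[p]) ^ k) *
      (PowerSeries.C (ϖ : ℚ_[p]) * padicLFunctionPlusBranchMult f (ap : ℚ_[p]) (p / 2)) := by
    rw [hιg, map_mul, mul_assoc]
  have hk : 0 ≤ k := Summit.BirchSwinnertonDyer.Rank1Residual.X9.exponent_nonneg_of_exists_norm_coeff_eq_one g _ k hιg' hcert
  obtain ⟨m, rfl⟩ : ∃ m : ℕ, k = m := ⟨k.toNat, (Int.toNat_of_nonneg hk).symm⟩
  have h0 := congrArg PowerSeries.constantCoeff hιg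
  rw [constantCoeff_iwasawaToPowerSeries, map_mul, PowerSeries.constantCoeff_C,
    constantCoeff_padicLFunctionPlusBranchMult_half p hp2 hf.1 hf.coeffField_eq_bot hpN hap hap0,
    zpow_natCast, hapinv, mul_assoc] at h0
  obtain ⟨ε, hε, hLq⟩ :=
    entireLFunction_one_eq_of_twist p hPal hmod hp4 V W hVW (Or.inr hV) hadd hf ϖ hϖ
  have hε0 : ε ≠ 0 := by rcases hε with rfl | rfl <;> norm_num
  have hεv : padicValRat p ε = 0 := by
    rcases hε with rfl | rfl
    · exact padicValRat.one
    · rw [padicValRat.neg]; exact padicValRat.one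
  obtain ⟨w, hw⟩ := exists_units_coe_eq_ratCast p hε0 hεv
  have hε2 : ((ε : ℚ) : ℚ_[p]) ^ 2 = 1 := by rcases hε with rfl | rfl <;> norm_num
  refine ⟨ε * (ϖ * legendrePlusSymbolSum f p), hLq,
    exists_padicInt_constantCoeff_generator_of_pow_mul D hchar hf' h0 ((ap : ℤ_[p]) * (w : ℤ_[p])) ?_⟩
  push_cast
  rw [hw]
  linear_combination (-(ϖ : ℚ_[p]) * (ap : ℚ_[p]) * (legendrePlusSymbolSum f p : ℚ_[p])) * hε2

/-- **(M), `p ≡ 3 (mod 4)` (`p = 3` included), per datum**: twist by `−p`, minus branch and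
`ϖ·|Ω⁻(V)| = Ω⁻_f`; the rational ODD branch main conjecture AT THIS DATUM and ONE unit coefficient ⟹
`CycLowerLeadingTermAt W p`. Proof = n1011-p06's `cycLowerLeadingTermAt_of_chiBranchRatCharEqMultOdd_of_unitCoeff`
verbatim with the predicate replaced by its value at the datum (odd Birch identity, Pal `d < 0` PROVED).
[cite: MazurTateTeitelbaum1986Invent, §I.14] -/
theorem cycLowerLeadingTermAt_of_ratCharEqMultOddDatum_of_unitCoeff {W : WeierstrassCurve ℚ}
    [W.IsElliptic] [W.IsGloballyMinimal]
    (hmod : hasEntireLFunction_rat) (hp4 : p % 4 = 3) (hadd : Addv W p)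
    (V : WeierstrassCurve ℚ) [V.IsElliptic] [V.IsGloballyMinimal]
    (C : VariableChange ℚ) (hC : C • V.quadraticTwist (-(p : ℚ)) = W) (hV : Mult V p)
    {N : ℕ} [NeZero N] {f : CuspForm (Gamma0 N) 2} (hf : IsNewformOf V f) (hpN : p ∣ N)
    {ap : ℤ} (hap : cuspCoeff f p = ap) (hap1 : ap = 1 ∨ ap = -1)
    (ϖ : ℚ) (hϖ : (ϖ : ℝ) * V.imaginaryPeriodRat = minusPeriod f)
    (hMC : ∀ (κ : ZpExtension ℚ p) (γ : Field.absoluteGaloisGroup ℚ), κ.IsCyclotomic →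
      κ.IsTopGenerator γ → IsCyclotomicVariable p γ → ∀ D : W.SelmerDualData κ γ,
      ∃ (g : IwasawaAlgebra p) (k : ℤ), D.charIdeal = Ideal.span {g} ∧
        iwasawaToPowerSeries p g = PowerSeries.C ((p : ℚ_[p]) ^ k * (ϖ : ℚ_[p])) *
          padicLFunctionMinusBranchMult f (ap : ℚ_[p]) (p / 2))
    (hcert : ∃ n : ℕ, ‖PowerSeries.coeff n
        (PowerSeries.C (ϖ : ℚ_[p]) * padicLFunctionMinusBranchMult f (ap : ℚ_[p]) (p / 2))‖ = 1) :
    CycLowerLeadingTermAt W p := by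
  have hpP : p.Prime := hp.out
  have hp2 : p ≠ 2 := by omega
  have hap0 : (ap : ℚ_[p]) ≠ 0 := by rcases hap1 with rfl | rfl <;> norm_num
  have hapinv : (ap : ℚ_[p])⁻¹ = (ap : ℚ_[p]) := by rcases hap1 with rfl | rfl <;> norm_num
  intro κ γ hκ hγ hγ' D f' hf'
  obtain ⟨g, k, hchar, hιg⟩ := hMC κ γ hκ hγ hγ' D
  have hιg' : iwasawaToPowerSeries p g = PowerSeries.C ((p : ℚ_[p]) ^ k) *
      (PowerSeries.C (ϖ : ℚ_[p]) * padicLFunctionMinusBranchMult f (ap : ℚ_[p]) (p / 2)) := by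
    rw [hιg, map_mul, mul_assoc]
  have hk : 0 ≤ k := Summit.BirchSwinnertonDyer.Rank1Residual.X9.exponent_nonneg_of_exists_norm_coeff_eq_one g _ k hιg' hcert
  obtain ⟨m, rfl⟩ : ∃ m : ℕ, k = m := ⟨k.toNat, (Int.toNat_of_nonneg hk).symm⟩
  have h0 := congrArg PowerSeries.constantCoeff hιg
  rw [constantCoeff_iwasawaToPowerSeries, map_mul, PowerSeries.constantCoeff_C,
    constantCoeff_padicLFunctionMinusBranchMult_half p hp2 hf.1 hf.coeffField_eq_bot hpN hap hap0,
    zpow_natCast, hapinv, mul_assoc] at h0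
  obtain ⟨ε, hε, hLq⟩ := entireLFunction_one_eq_of_twist_neg p hmod hp4 V W C hC hadd hf ϖ hϖ
  set S : ℚ := legendreMinusSymbolSum f p with hS
  set cinf : ℕ := (W.baseChange ℝ).numRealComponents with hcinf
  have hε0 : ε ≠ 0 := by rcases hε with rfl | rfl <;> norm_num
  have hεv : padicValRat p ε = 0 := by
    rcases hε with rfl | rfl
    · exact padicValRat.one
    · rw [padicValRat.neg]; exact padicValRat.one
  have hua0 : |(C.u : ℚ)| ≠ 0 := abs_ne_zero.mpr C.u.ne_zero
  have hcinf0 : (cinf : ℚ) ≠ 0 := by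
    rw [hcinf, numRealComponents]
    split_ifs <;> norm_num
  have hC'' : C • V.quadraticTwist (((-(p : ℤ)) : ℤ) : ℚ) = W := by push_cast; exact hC
  have hu : padicValRat p (C.u : ℚ) = 0 :=
    padicValRat_u_eq_zero_of_twist_pm_p p hp2 V W (Or.inr hV) (Or.inr rfl) C hC''
  have hvua : padicValRat p |(C.u : ℚ)| = 0 := by
    rcases abs_choice (C.u : ℚ) with h | h
    · rw [h]; exact hu
    · rw [h, padicValRat.neg]; exact hu
  have hd0 : ε * (|(C.u : ℚ)| * (cinf : ℚ)) ≠ 0 := mul_ne_zero hε0 (mul_ne_zero hua0 hcinf0)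
  have hdv : padicValRat p (ε * (|(C.u : ℚ)| * (cinf : ℚ))) = 0 := by
    rw [padicValRat.mul hε0 (mul_ne_zero hua0 hcinf0), padicValRat.mul hua0 hcinf0, hεv, hvua,
      hcinf, padicValRat_numRealComponents_eq_zero W p hp2]
    norm_num
  obtain ⟨w, hw⟩ := exists_units_coe_eq_ratCast p hd0 hdv
  have key : ϖ * S =
      (ε * (|(C.u : ℚ)| * (cinf : ℚ))) * (ε * (ϖ * S) / (|(C.u : ℚ)| * (cinf : ℚ))) := by
    have hε2Q : ε ^ 2 = 1 := by rcases hε with rfl | rfl <;> norm_num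
    have hdinv : (|(C.u : ℚ)| * (cinf : ℚ)) * (|(C.u : ℚ)| * (cinf : ℚ))⁻¹ = 1 :=
      mul_inv_cancel₀ (mul_ne_zero hua0 hcinf0)
    rw [div_eq_mul_inv]
    linear_combination (-(ϖ * S)) * hε2Q + (-(ϖ * S * ε ^ 2)) * hdinv
  have hq : ((w : ℤ_[p]) : ℚ_[p]) * (((ε * (ϖ * S) / (|(C.u : ℚ)| * (cinf : ℚ))) : ℚ) : ℚ_[p]) =
      (ϖ : ℚ_[p]) * (S : ℚ_[p]) := by
    rw [hw, ← Rat.cast_mul, ← key, Rat.cast_mul]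
  refine ⟨ε * (ϖ * S) / (|(C.u : ℚ)| * (cinf : ℚ)), hLq,
    exists_padicInt_constantCoeff_generator_of_pow_mul D hchar hf' h0 ((ap : ℤ_[p]) * (w : ℤ_[p])) ?_⟩
  rw [PadicInt.coe_mul, PadicInt.coe_intCast]
  linear_combination (-(ap : ℚ_[p])) * hq

/-! ### §2 HEADLINE: X4(M) ∩ {ρ̄ onto} ∩ (ram), `r_an = 0` — the lower half modulo (BC) and ONE unit coefficient -/

/-- **X4(M) ∩ {ρ̄_{E,p} onto} ∩ (ram), analytic rank `0`, EVERY odd `p`: the LOWER half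
`ord_p #Ш(E)_an ≤ ord_p #Ш(E)` from PUBLISHED facts + (BC) + ONE unit coefficient.** Published, BY NAME:
`hDelX` (Delbourgo 1998 Prop. 4 + §2.2 Lemma (ii), exact on (M)), `hPal` (Pal 2012 Thm. 3.2, used at
`p ≡ 1 (4)` only), `hGZK`, `hmod`, `hmodD`, `hK` (Kato 2004 Thm. 17.4 (3) half-eigenspace reading — the
E-side brick), `hA` (Skinner 2016 Thm. A — supplies (KV) at the newform of a parametrisation datum of the
twist model, `katoV_of_skinner2016`; (irr) for `V` from `Irr W p` by `irr_iff_of_model_twist`, (ram) for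
`V` from `Ram W p` by `ram_of_twist_pStar`). DISPLAYED: **(BC)** — for every globally minimal
multiplicative twist model `V` (`C • V^{(p*)} = W`), every parametrisation datum `Dm` of `V` with
`a_p(Dm.f) = ap`, every cyclotomic datum, all dual data `DV`/`D` of `V`/`E`, at THE `p`-adic
`L`-function `L` of `IsMultPAdicLFunctionOf Dm.f p ap`: `∃ m n G`, `ι(X^e·G) = p^n·L·L^±_br(Dm.f, ap)`
and `p^m·char X(V/ℚ_∞)·char X(E/ℚ_∞) ⊆ (G)` (the base-change product bound for `V` over `ℚ(√p*)`,
descended; `p` RAMIFIED: NOT in print) — and the unit-coefficient certificate of the parity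
(`MultBranchUnitCoeffCert` / `MultOddBranchUnitCoeffCert`, one modular-symbol computation on `V` per
pair). Conclusion: `MissingLowerBoundAt W p`, i.e. the crux's `stub_rankZero` at the pair. Chain:
transport (`isTorsion_and_charIdeal_eq_span_branchMult_of_katoV_of_baseChangeLower`) ⟹ rational branch MC
at the datum ⟹ §1 ⟹ `CycLowerLeadingTermAt` ⟹ `CycLeadingTermDvdAt` ⟹ n1011-p18's
`ClassX4M.missingLowerBoundAt_rankZero_of_cycLeadingTermDvd`. Conditional on (BC); X4(M) stays
CONSTRUCTION-shaped; nothing booked. [cite: Skinner2016PacificMC, Thm. A (§1), §3.2, §3.3]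
[cite: Kato2004Asterisque, Thm. 17.4 (3) (p. 273)] [cite: Delbourgo1998, Prop. 4 (p. 144), §2.2 Lemma (ii) (p. 139)]
[cite: Pal2012, Thm. 3.2] [cite: BurungaleCastellaSkinner2025, Thm. 1.1.2 (a) (shape of (BC))] -/
theorem ClassX4M.missingLowerBoundAt_rankZero_of_skinner_of_baseChangeLower_of_unitCoeff
    [W.IsElliptic] [W.IsGloballyMinimal]
    (hDelX : Delbourgo1998.prop4_rankZero_constantCoeff_eq_unit_mul_of_potMult)
    (hPal : Pal2012.thm32_sqrt_mul_realPeriodRat_twist_eq_of_prime_one_mod_four)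
    (hGZK : rank_eq_analyticRank_of_analyticRank_le_one) (hmod : hasEntireLFunction_rat)
    (hmodD : nonempty_modularParametrizationData)
    (hK : Wuthrich2014.kato_halfEigenCharIdeal_dvd_cyclotomicPrime_of_surjective)
    (hA : Skinner2016.thmA_charIdeal_multiplicative)
    (hX : ClassX4M W p) (hsurj : Surj W p) (hram : Ram W p) (hr : W.analyticRank = 0)
    (hBC : ∀ (V : WeierstrassCurve ℚ) [V.IsElliptic] [V.IsGloballyMinimal] (C : VariableChange ℚ),
      Mult V p → C • V.quadraticTwist ((-1 : ℚ) ^ (p / 2) * p) = W →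
      ∀ {N : ℕ} [NeZero N] (Dm : ModularParametrizationData V N) (ap : ℤ), cuspCoeff Dm.f p = ap →
      ∀ (κ : ZpExtension ℚ p) (γ : Field.absoluteGaloisGroup ℚ),
        κ.IsCyclotomic → κ.IsTopGenerator γ → IsCyclotomicVariable p γ →
      ∀ (DV : V.SelmerDualData κ γ) (D : W.SelmerDualData κ γ) (L : PowerSeries ℚ_[p]),
        IsMultPAdicLFunctionOf Dm.f p ((ap : ℤ) : ℚ_[p]) L →
        ∃ (m n : ℕ) (G : IwasawaAlgebra p),
          iwasawaToPowerSeries p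
              (PowerSeries.X ^ (if V.HasSplitMultiplicativeReductionAtPrime p then 1 else 0) * G) =
            PowerSeries.C ((p : ℚ_[p]) ^ n) *
              (L * (if Even (p / 2) then padicLFunctionPlusBranchMult Dm.f ((ap : ℤ) : ℚ_[p]) (p / 2)
                else padicLFunctionMinusBranchMult Dm.f ((ap : ℤ) : ℚ_[p]) (p / 2))) ∧
          ∀ x ∈ DV.charIdeal, ∀ y ∈ D.charIdeal,
            PowerSeries.C ((p : ℤ_[p]) ^ m) * (x * y) ∈ Ideal.span {G})
    (hcert₁ : p % 4 = 1 → MultBranchUnitCoeffCert W p)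
    (hcert₃ : p % 4 = 3 → MultOddBranchUnitCoeffCert W p) : MissingLowerBoundAt W p := by
  have hp2 : p ≠ 2 := hX.p_ne_two
  have hp3 : 3 ≤ p := Nat.succ_le_of_lt (lt_of_le_of_ne hp.out.two_le (Ne.symm hp2))
  have hodd : p % 4 = 1 ∨ p % 4 = 3 := by
    obtain ⟨k, hk⟩ := hp.out.odd_of_ne_two hp2
    omega
  -- the twist datum, the parametrisation datum and the real period ratio
  obtain ⟨V, iV, iVm, C, hV, hC⟩ := hX.exists_mult_pStar_twist_model
  haveI : NeZero (V.conductorNorm ℤ) := ⟨(V.conductorNorm_pos_holds).ne'⟩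
  obtain ⟨Dm⟩ := hmodD V
  obtain ⟨ϖp, hϖpos, hϖp, -⟩ := Dm.exists_rat_mul_realPeriodRat_eq_plusPeriod
  have hirrV : Irr V p := (irr_iff_of_model_twist (W := V) (pStar_ne_zero p) ⟨C, hC⟩).mp hX.1.2.2
  have hsurjV : ∀ n : ℕ, V.HasSurjectiveModNGaloisRep (p ^ n : ℕ) :=
    (ClassX4M.potMult W p hX).towerSurj_twist_of_surj hp2 hsurj V C hC
  -- (ram) for the twist model
  have hramV : Ram V p := by
    rcases hodd with h | h
    · have hC' : C • V.quadraticTwist (((p : ℤ) : ℤ) : ℚ) = W := by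
        rw [pStar_eq_of_mod_four p (Or.inl h), if_pos h] at hC
        exact_mod_cast hC
      exact ram_of_twist_pStar p V (k := ((p / 4 : ℕ) : ℤ)) (by omega) (Or.inl rfl) C hC' hram
    · have hC' : C • V.quadraticTwist (((-(p : ℤ)) : ℤ) : ℚ) = W := by
        rw [pStar_eq_of_mod_four p (Or.inr h), if_neg (by omega)] at hC
        exact_mod_cast hC
      exact ram_of_twist_pStar p V (k := -(((p + 1) / 4 : ℕ) : ℤ)) (by omega) (Or.inr rfl) C hC' hram
  -- the sign `a_p(V) = ±1` and `p ∣ N`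
  obtain ⟨ap, hap, hap1, hpN⟩ : ∃ ap : ℤ, cuspCoeff Dm.f p = ((ap : ℤ) : ℂ) ∧ (ap = 1 ∨ ap = -1) ∧
      p ∣ _ := by
    by_cases hs : V.HasSplitMultiplicativeReductionAtPrime p
    · exact ⟨1, by exact_mod_cast (Dm.isNewformOf.cuspCoeff_eq_one_and_sq_of_split hs).1, Or.inl rfl,
        Dm.isNewformOf.dvd_level_of_split hs⟩
    · obtain ⟨h1, h2⟩ := Dm.isNewformOf.cuspCoeff_eq_neg_one_and_dvd_of_nonsplit hV hs
      exact ⟨-1, by exact_mod_cast h1, Or.inr rfl, h2⟩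
  -- (KV) at the datum: Skinner 2016 Thm. A
  have hKV : ∀ {κ : ZpExtension ℚ p} {γ : Field.absoluteGaloisGroup ℚ}, κ.IsCyclotomic →
      κ.IsTopGenerator γ → IsCyclotomicVariable p γ →
      ∀ (DV : V.SelmerDualData κ γ) (L : PowerSeries ℚ_[p]),
        IsMultPAdicLFunctionOf Dm.f p ((ap : ℤ) : ℚ_[p]) L →
        ∃ (a : ℕ) (h : IwasawaAlgebra p), h ∈ DV.charIdeal ∧
          iwasawaToPowerSeries p
              (PowerSeries.X ^ (if V.HasSplitMultiplicativeReductionAtPrime p then 1 else 0) * h) =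
            PowerSeries.C ((p : ℚ_[p]) ^ a) * L :=
    fun hκ hγ hcv DV L hL ↦ katoV_of_skinner2016 p hA hp3 hV hirrV hramV hκ hγ hcv Dm.isNewformOf hap
      hϖpos.ne' hϖp DV L hL
  rcases hodd with h1 | h3
  · -- even branch: `ϖ = ϖ⁺`
    have heven : Even (p / 2) := ⟨p / 4, by omega⟩
    have hϖ' : (if Even (p / 2) then (ϖp : ℝ) * V.realPeriodRat = plusPeriod Dm.f
        else (ϖp : ℝ) * V.imaginaryPeriodRat = minusPeriod Dm.f) := by
      rw [if_pos heven]; exact hϖp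
    have hC1 : C • V.quadraticTwist (p : ℚ) = W := by
      rw [pStar_eq_of_mod_four p (Or.inl h1), if_pos h1] at hC
      exact hC
    have hMC : ∀ (κ : ZpExtension ℚ p) (γ : Field.absoluteGaloisGroup ℚ), κ.IsCyclotomic →
        κ.IsTopGenerator γ → IsCyclotomicVariable p γ → ∀ D : W.SelmerDualData κ γ,
        ∃ (g : IwasawaAlgebra p) (k : ℤ), D.charIdeal = Ideal.span {g} ∧
          iwasawaToPowerSeries p g = PowerSeries.C ((p : ℚ_[p]) ^ k * (ϖp : ℚ_[p])) *
            padicLFunctionPlusBranchMult Dm.f (ap : ℚ_[p]) (p / 2) := by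
      intro κ γ hκ hγ hcv D
      obtain ⟨-, g, k, hspan, hι⟩ :=
        isTorsion_and_charIdeal_eq_span_branchMult_of_katoV_of_baseChangeLower p V hV Dm.isNewformOf
          hap hγ D ϖp hϖ'
          (fun B hdisj ↦ isTorsion_and_exists_iota_eq_of_katoHalf hK hp2 V C hC hsurjV hκ hγ hcv
            Dm.isNewformOf D B hdisj ϖp hϖ')
          (fun DV L hL ↦ hKV hκ hγ hcv DV L hL)
          (fun DV L hL ↦ hBC V C hV hC Dm ap hap κ γ hκ hγ hcv DV D L hL)
      rw [if_pos heven] at hι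
      exact ⟨g, k, hspan, hι⟩
    exact hX.missingLowerBoundAt_rankZero_of_cycLeadingTermDvd hDelX hGZK hmod hr
      (cycLeadingTermDvdAt_of_cycLowerLeadingTermAt (W := W) (p := p)
        (cycLowerLeadingTermAt_of_ratCharEqMultDatum_of_unitCoeff p hPal hmod h1 hX.1.2.1 V ⟨C, hC1⟩ hV
          Dm.isNewformOf hpN hap hap1 ϖp hϖp hMC
          (hcert₁ h1 V C hV hC1 Dm.f Dm.isNewformOf ap hap ϖp hϖp)))
  · -- odd branch: `ϖ⁻ · |Ω⁻(V)| = Ω⁻_f`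
    have hnot : ¬ Even (p / 2) := by rw [Nat.not_even_iff_odd]; exact ⟨p / 4, by omega⟩
    obtain ⟨ϖm, -, hϖm⟩ := exists_rat_mul_imaginaryPeriodRat_eq_minusPeriod Dm
    have hϖ' : (if Even (p / 2) then (ϖm : ℝ) * V.realPeriodRat = plusPeriod Dm.f
        else (ϖm : ℝ) * V.imaginaryPeriodRat = minusPeriod Dm.f) := by
      rw [if_neg hnot]; exact hϖm
    have hC3 : C • V.quadraticTwist (-(p : ℚ)) = W := by
      rw [pStar_eq_of_mod_four p (Or.inr h3), if_neg (by omega)] at hC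
      exact hC
    have hMC : ∀ (κ : ZpExtension ℚ p) (γ : Field.absoluteGaloisGroup ℚ), κ.IsCyclotomic →
        κ.IsTopGenerator γ → IsCyclotomicVariable p γ → ∀ D : W.SelmerDualData κ γ,
        ∃ (g : IwasawaAlgebra p) (k : ℤ), D.charIdeal = Ideal.span {g} ∧
          iwasawaToPowerSeries p g = PowerSeries.C ((p : ℚ_[p]) ^ k * (ϖm : ℚ_[p])) *
            padicLFunctionMinusBranchMult Dm.f (ap : ℚ_[p]) (p / 2) := by
      intro κ γ hκ hγ hcv D
      obtain ⟨-, g, k, hspan, hι⟩ :=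
        isTorsion_and_charIdeal_eq_span_branchMult_of_katoV_of_baseChangeLower p V hV Dm.isNewformOf
          hap hγ D ϖm hϖ'
          (fun B hdisj ↦ isTorsion_and_exists_iota_eq_of_katoHalf hK hp2 V C hC hsurjV hκ hγ hcv
            Dm.isNewformOf D B hdisj ϖm hϖ')
          (fun DV L hL ↦ hKV hκ hγ hcv DV L hL)
          (fun DV L hL ↦ hBC V C hV hC Dm ap hap κ γ hκ hγ hcv DV D L hL)
      rw [if_neg hnot] at hι
      exact ⟨g, k, hspan, hι⟩
    exact hX.missingLowerBoundAt_rankZero_of_cycLeadingTermDvd hDelX hGZK hmod hr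
      (cycLeadingTermDvdAt_of_cycLowerLeadingTermAt (W := W) (p := p)
        (cycLowerLeadingTermAt_of_ratCharEqMultOddDatum_of_unitCoeff p hmod h3 hX.1.2.1 V C hC3 hV
          Dm.isNewformOf hpN hap hap1 ϖm hϖm hMC
          (hcert₃ h3 V C hV hC3 Dm.f Dm.isNewformOf ap hap ϖm hϖm)))

end Summit.BirchSwinnertonDyer.BirchSwinnertonDyer.Theorems.AdditiveBranchIMCMultLower

end
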